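import Mathlib
import HarnessLib
import Summits.HubbardSuperconductivity.HubbardSuperconductivity.Theorems.KLProgrammeKLRegimeSectorOverlapDefectRate
import Summits.HubbardSuperconductivity.HubbardSuperconductivity.Theorems.KLProgrammeKLRegimeEngineAnisoTorusSumWtFlow
import Summits.HubbardSuperconductivity.HubbardSuperconductivity.Theorems.KLProgrammeKLRegimeEngineSymbolThresholds
import Summits.HubbardSuperconductivity.HubbardSuperconductivity.Theorems.KLProgrammeH10TwoPointLimitFramePerturbation
import Summits.HubbardSuperconductivity.HubbardSuperconductivity.Theorems.KLProgrammeKLRegimeSymbolFrameProfileThird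
import Summits.HubbardSuperconductivity.HubbardSuperconductivity.Theorems.KLProgrammeKLRegimeEngineThresholdBridges
import Summits.HubbardSuperconductivity.HubbardSuperconductivity.Theorems.KLProgrammeKLRegimeVolumeLimitFlowFramesJets
import Summits.HubbardSuperconductivity.HubbardSuperconductivity.Theorems.KLProgrammeKLRegimeVolumeLimitV11HinstDoors
import Summits.HubbardSuperconductivity.HubbardSuperconductivity.Theorems.KLProgrammeKLRegimeTwoVolumeTowerDefs

/-!
# Route `KLProgramme` — crux K3, VL child (stmt-HubbardSuperconductivity-20440): THE TRANSFER HALF OF THE ATOM `Hmis` IS A THEOREM UNDER THE TOWER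
# (seat hubbard-kl-k3c4-p1 g17; supplier: k3c4-p2 g12's `…SectorOverlapDefectRate.exists_overlapDefect_rate_of_frames` (p587829) at the regime data of
# p4/k3c1's symbol layer (`bandBounds`, `κ₀`, `klEngC₃3_le_symbolC₃`, `klEngU₀3_le_symbolU₀`), fed by the tower's frame comparison `coeffNorm_fsub_klFlowFrameU_le_of_towerV17F2`)

`Hmis` (DISCHARGER-GUIDE-g16 §2 / binder of `…V11TowerDataWOfGridM.stub_vl_towerDataW_WF2_of_gridM`) asks for rates `sE cR cC` of the STEP-COVARIANCE frame
mismatch and `δ` of the TOWER-TRANSFER frame mismatch `klTowerTransfer (bL) M β μ K_{bL} j − klTowerTransfer (bL) M β μ K_L j` (rows and columns, `j ≤ n_β`).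
The transfer `T⁺_k = klSrcTransfer … k` is `klReanalysis … k = (ε • E(F_{k+1}[K]))·S(F̃_k[K])` on the alive copies and the FRAME-FREE slot shift on the
source copies, so its mismatch is the re-sectorisation frame defect `ε·(E[K′]S[K′] − E[K]S[K])`, whose rows/columns are `≤ C_k·ε_L` by k3c4-p2's
`exists_overlapDefect_rate_of_frames` once both flow frames have `C²` size `≤ A = κ₀/4` (regime: `c ≤ klEngC₃3`, `U ≤ klEngU₀3`) and
`ε_L ≥ max_{j≤2} coeffNorm j (K_L ⊖ K_{bL})` (`= (|A₀|+|A₁|+|A₂|)/L` from the tower).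
* §1 `klSrcTransfer_sub_apply`, `sum_norm_klSrcTransfer_sub_row_le` / `_col_le`, `norm_klReanalysis_sub_apply`, `klTowerTransfer_zero_sub`;
* §2 **`hmisTransfer_of_towerP`** — for every `(G, P, Q, R)` with `R.WF2`: `c ≤ klEngC₃3 P R`, `U ≤ klEngU₀3 P R c`; under `TowerP klPredsV17F2 …`:
  `∃ δ : ℕ → ℕ → ℝ`, `0 ≤ δ j L ≤ 1`, `δ j → 0`, `∃ L₂ M₂`, at every instance the transfer-mismatch rows and columns are `≤ δ j L` for all `j ≤ n_β`
  — conjuncts 4–5 of `Hmis`'s instance block with their sign/cap/limit clauses; the step-covariance half (`sE cR cC`) remains (k3c4-p2's M2 bricks).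

Proofs only; no definition; nothing asserts Hmis, any stub, K3, VL or superconductivity.
[cite: BenfattoGiulianiMastropietro2006, §2.7 (2.71a), §3 (3.3)]
-/

noncomputable section

namespace Summit.HubbardSuperconductivity.HubbardSuperconductivity.Theorems.TwoVolumeSource

set_option linter.dupNamespace false -- summit = problem name (single-conjunct summit), D-0017

open Finset Filter Topology Literature.MathematicalPhysics.QuantumLattice GrassmannAlgebra Literature.Probability.LatticeModels
  Literature.Probability.LatticeModels.BattleFederbush Literature.MathematicalPhysics.QuantumLattice.BandSectorCounting
open Summit.HubbardSuperconductivity.HubbardSuperconductivity.Theorems.TwoPointAssembly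
open Summit.HubbardSuperconductivity.HubbardSuperconductivity.Theorems.KLRegimeSplit
open Summit.HubbardSuperconductivity.HubbardSuperconductivity.Theorems.KLProgrammeLegKernels
open Summit.HubbardSuperconductivity.HubbardSuperconductivity.Theorems.EngineV8
open Summit.HubbardSuperconductivity.HubbardSuperconductivity.Theorems.TwoVolumeDefect
open Summit.HubbardSuperconductivity.HubbardSuperconductivity.Theorems.TorusFourierL2
open Summit.HubbardSuperconductivity.HubbardSuperconductivity.Theorems.PerturbedFermiCurve
open Summit.HubbardSuperconductivity.HubbardSuperconductivity.Theorems.DispersionFlow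
open scoped Real

/-! ## §1 The transfer's frame difference lives on the alive copies -/

section Entries

variable {V M : ℕ} [NeZero V]

/-- **The frame difference of the doubled transfer, entrywise**: the re-analysis difference on the alive copies, `0` elsewhere (the slot shift is frame-free).
[folklore] -/
theorem klSrcTransfer_sub_apply (β μ : ℝ) (K' K : TrigPolyC4v) (k : ℕ) (p' : SrcLabel V M (k + 1)) (p : SrcLabel V M k) :
    klSrcTransfer V M β μ K' k p' p - klSrcTransfer V M β μ K k p' p =
      if p'.2 = 0 ∧ p.2 = 0 then (klReanalysis V M β μ K' k - klReanalysis V M β μ K k) p'.1 p.1 else 0 := by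
  simp only [klSrcTransfer, Matrix.of_apply]
  split_ifs with h00 h11
  · rw [Matrix.sub_apply]
  · exact sub_self _
  · exact sub_self _

/-- **Rows of the transfer's frame difference from rows of the re-analysis difference.** [folklore] -/
theorem sum_norm_klSrcTransfer_sub_row_le (β μ : ℝ) (K' K : TrigPolyC4v) (k : ℕ) {δ : ℝ} (hδ : 0 ≤ δ)
    (hrow : ∀ Y' : SpaceTimeIdx V M × SectorLeg (sectorCount (k + 1)), ∑ Y : SpaceTimeIdx V M × SectorLeg (sectorCount k),
      ‖(klReanalysis V M β μ K' k - klReanalysis V M β μ K k) Y' Y‖ ≤ δ)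
    (x : SrcLabel V M (k + 1)) :
    ∑ y : SrcLabel V M k, ‖klSrcTransfer V M β μ K' k x y - klSrcTransfer V M β μ K k x y‖ ≤ δ := by
  obtain ⟨Y', c⟩ := x
  simp_rw [klSrcTransfer_sub_apply]
  revert c
  rw [Fin.forall_fin_two]
  refine ⟨?_, ?_⟩
  · rw [Fintype.sum_prod_type]
    simp_rw [Fin.sum_univ_two]
    simp only [true_and, if_true, Fin.one_eq_zero_iff, OfNat.ofNat_ne_one, if_false, norm_zero, add_zero]
    exact hrow Y'
  · rw [Fintype.sum_prod_type]
    simp only [Fin.one_eq_zero_iff, OfNat.ofNat_ne_one, false_and, if_false, norm_zero, Finset.sum_const_zero]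
    exact hδ

/-- **Columns of the transfer's frame difference from columns of the re-analysis difference.** [folklore] -/
theorem sum_norm_klSrcTransfer_sub_col_le (β μ : ℝ) (K' K : TrigPolyC4v) (k : ℕ) {δ : ℝ} (hδ : 0 ≤ δ)
    (hcol : ∀ Y : SpaceTimeIdx V M × SectorLeg (sectorCount k), ∑ Y' : SpaceTimeIdx V M × SectorLeg (sectorCount (k + 1)),
      ‖(klReanalysis V M β μ K' k - klReanalysis V M β μ K k) Y' Y‖ ≤ δ)
    (y : SrcLabel V M k) :
    ∑ x : SrcLabel V M (k + 1), ‖klSrcTransfer V M β μ K' k x y - klSrcTransfer V M β μ K k x y‖ ≤ δ := by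
  obtain ⟨Y, c⟩ := y
  simp_rw [klSrcTransfer_sub_apply]
  revert c
  rw [Fin.forall_fin_two]
  refine ⟨?_, ?_⟩
  · rw [Fintype.sum_prod_type]
    simp_rw [Fin.sum_univ_two]
    simp only [and_true, if_true, Fin.one_eq_zero_iff, OfNat.ofNat_ne_one, if_false, norm_zero, add_zero]
    exact hcol Y
  · rw [Fintype.sum_prod_type]
    simp only [Fin.one_eq_zero_iff, OfNat.ofNat_ne_one, and_false, if_false, norm_zero, Finset.sum_const_zero]
    exact hδ

/-- **The re-analysis difference is `ε ×` the re-sectorisation frame defect** (`β ≥ 0`). [folklore] -/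
theorem norm_klReanalysis_sub_apply {β : ℝ} (hβ : 0 ≤ β) (μ : ℝ) (K' K : TrigPolyC4v) (k : ℕ)
    (Y' : SpaceTimeIdx V M × SectorLeg (sectorCount (k + 1))) (Y : SpaceTimeIdx V M × SectorLeg (sectorCount k)) :
    ‖(klReanalysis V M β μ K' k - klReanalysis V M β μ K k) Y' Y‖ =
      imagTimeWeight β M *
        ‖(sectorAnalysisMatrix V M β (klAnisoFamily V M β μ K' klE0 (k + 1)) * sectorSubMatrix V M β (bgmFatMultiplier V M klE0 β (nambuXiCT V μ K') k) -
          sectorAnalysisMatrix V M β (klAnisoFamily V M β μ K klE0 (k + 1)) * sectorSubMatrix V M β (bgmFatMultiplier V M klE0 β (nambuXiCT V μ K) k)) Y' Y‖ := by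
  rw [Matrix.sub_apply, klReanalysis, klReanalysis, Matrix.smul_mul, Matrix.smul_mul]
  exact norm_real_smul_apply_sub _ _ (imagTimeWeight_nonneg hβ M) Y' Y

end Entries

/-! ## §2 The transfer half of `Hmis` under the tower -/

set_option maxHeartbeats 1600000 in -- long regime bookkeeping with explicit constants
/-- **THE TRANSFER HALF OF `Hmis` IS A THEOREM UNDER THE TOWER** (see the module docstring).  [cite: BenfattoGiulianiMastropietro2006, §2.7 (2.71a), §3 (3.3)] -/
theorem hmisTransfer_of_towerP (G : GeoConsts) (P : SplitConsts) (Q : EngConsts) (R : RenConsts) (hR2 : R.WF2) :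
    ∃ c₇ : ℝ, 0 < c₇ ∧ ∀ c : ℝ, 0 < c → c ≤ c₇ → ∃ U₇ : ℝ, 0 < U₇ ∧
      ∀ μ ∈ klWindowC, ∀ U : ℝ, 0 < U → U ≤ U₇ → ∀ β : ℝ, klBetaMin ≤ β → β ≤ Real.exp (c / U ^ 2) →
        ∀ (K : TrigPolyC4v) (Lstar : ℕ) (Mstar : ℕ → ℕ), TowerP klPredsV17F2 G P Q R β U μ K Lstar Mstar →
        ∃ δ : ℕ → ℕ → ℝ, (∀ j L, 0 ≤ δ j L ∧ δ j L ≤ 1) ∧ (∀ j, Tendsto (δ j) atTop (𝓝 0)) ∧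
        ∃ L₂ : ℕ, ∃ M₂ : ℕ → ℕ → ℕ, ∀ (L b M : ℕ) [NeZero L] [NeZero (b * L)] [NeZero M], L₂ ≤ L → M₂ L b ≤ M →
          (∀ j, j ≤ nScales β → ∀ x, ∑ y, ‖klTowerTransfer (b * L) M β μ (klFlowFrameU (b * L) M β U μ (nScales β + 1)) j x y -
              klTowerTransfer (b * L) M β μ (klFlowFrameU L M β U μ (nScales β + 1)) j x y‖ ≤ δ j L) ∧
          (∀ j, j ≤ nScales β → ∀ y, ∑ x, ‖klTowerTransfer (b * L) M β μ (klFlowFrameU (b * L) M β U μ (nScales β + 1)) j x y -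
              klTowerTransfer (b * L) M β μ (klFlowFrameU L M β U μ (nScales β + 1)) j x y‖ ≤ δ j L) := by
  classical
  have ha : (-4 : ℝ) < -(6 / 5) := by norm_num
  have hab : (-(6 / 5) : ℝ) ≤ -(1 / 10) := by norm_num
  have hb : (-(1 / 10) : ℝ) < 0 := by norm_num
  -- the window band bounds and the absolute frame-size threshold (as in `…EngineAnisoTorusSumWtFlow`)
  set B : BandBounds (-(6 / 5)) (-(1 / 10)) := bandBounds ha hab hb with hBdef
  set κ₀ : ℝ := min (min (B.Dtmin / 4) (B.rhomin / 4)) (1 / 40) with hκ₀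
  have hDt := B.Dtmin_pos
  have hrh := B.rhomin_pos
  have hκ₀pos : 0 < κ₀ := by rw [hκ₀]; exact lt_min (lt_min (by positivity) (by positivity)) (by norm_num)
  have hκ₀Dt : κ₀ ≤ B.Dtmin / 4 := (min_le_left _ _).trans (min_le_left _ _)
  have hκ₀rh : κ₀ ≤ B.rhomin / 4 := (min_le_left _ _).trans (min_le_right _ _)
  have hκ₀40 : κ₀ ≤ 1 / 40 := min_le_right _ _
  have he : (0 : ℝ) < klE0 := by norm_num [klE0]
  obtain ⟨d₀, hd₀, hd₀1, hd₀2, hd₀3⟩ := exists_abs_derivs3_bgmCutoffSq_le he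
  set A : ℝ := κ₀ / 4 with hAdef
  have hA0 : 0 < A := by rw [hAdef]; positivity
  have hADt : 2 * A < B.Dtmin := by rw [hAdef]; linarith
  have hρA : 4 * A < 2 * B.rhomin := by rw [hAdef]; linarith
  have hRj : ∀ j, 0 ≤ R.Gfr j := gfr_nonneg_of_wf2 hR2
  refine ⟨klEngC₃3 P R, klEngC₃3_pos P R, fun c hc hc3 => ⟨klEngU₀3 P R c, klEngU₀3_pos P R c,
    fun μ hμ U hU hU3' β hβmin hβc K Lstar Mstar hT => ?_⟩⟩
  have hβ0 : 0 < β := KLRegimeSplit.pos_of_klBetaMin_le hβmin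
  have hcle : c ≤ κ₀ / (12 * (R.Gfr 2 + 1)) := hc3.trans (klEngC₃3_le_symbolC₃ ha hab hb P hRj)
  have hU3 : U ≤ min 1 (κ₀ / (24 * (R.Gfr 0 + R.Gfr 1 + 1))) := hU3'.trans (klEngU₀3_le_symbolU₀ ha hab hb P hRj c)
  have hU1 : U ≤ 1 := hU3.trans (min_le_left _ _)
  -- the window margins
  have hμ' := hμ
  simp only [klWindowC, Set.mem_Icc] at hμ'
  have e1 : (-1.05 : ℝ) = -(21 / 20) := by norm_num
  have e2 : (-0.15 : ℝ) = -(3 / 20) := by norm_num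
  have hμlo : -(21 / 20 : ℝ) ≤ μ := by rw [← e1]; exact hμ'.1
  have hμhi : μ ≤ -(3 / 20 : ℝ) := by rw [← e2]; exact hμ'.2
  have he0 : klE0 = 1 / 32 := rfl
  have hgap : klE0 + A + (1 / 10 : ℝ) ^ 2 < -μ := by rw [he0, hAdef]; linarith only [hμhi, hκ₀40]
  have h3 : klE0 + A - μ ≤ 3 := by rw [he0, hAdef]; linarith only [hμlo, hκ₀40]
  have hlo : (-(6 / 5) : ℝ) ≤ μ - A - klE0 := by rw [he0, hAdef]; linarith only [hμlo, hκ₀40]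
  have hhi : μ + A + klE0 ≤ -(1 / 10) := by rw [he0, hAdef]; linarith only [hμhi, hκ₀40]
  -- the `C²` size of every admissible frame is `≤ A`
  have hlog : 1 ≤ Real.log 4 := by
    have h4 : Real.exp 1 ≤ 4 := by have := Real.exp_one_lt_d9; norm_num at this; linarith
    calc (1 : ℝ) = Real.log (Real.exp 1) := (Real.log_exp 1).symm
      _ ≤ Real.log 4 := Real.log_le_log (Real.exp_pos 1) h4
  have hAK : ∀ K' : TrigPolyC4v, FrameOK R U (nScales β) μ K' → ∀ p : Momentum, ∀ j ≤ 2, ‖iteratedFDeriv ℝ j (frameShift K') p‖ ≤ A := by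
    intro K' hfr p j hj
    refine (norm_iteratedFDeriv_frameShift_le_of_frameOK_regime hRj hc.le hβmin hβc hfr p hj).trans ?_
    have h0 := hRj 0; have h1 := hRj 1; have h2 := hRj 2
    have hUk : U ≤ κ₀ / (24 * (R.Gfr 0 + R.Gfr 1 + 1)) := hU3.trans (min_le_right _ _)
    rw [abs_of_pos hU]
    have hU2 : U ^ 2 ≤ U := by nlinarith only [hU, hU1]
    have hA1 : 2 * R.Gfr 0 * U + 2 * R.Gfr 1 * U ^ 2 ≤ 2 * (R.Gfr 0 + R.Gfr 1 + 1) * U := by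
      have := mul_le_mul_of_nonneg_left hU2 h1
      linarith only [this, hU.le]
    have hB1 : 2 * (R.Gfr 0 + R.Gfr 1 + 1) * U ≤ κ₀ / 12 := by
      have hpos : 0 < 24 * (R.Gfr 0 + R.Gfr 1 + 1) := by positivity
      have := (le_div_iff₀ hpos).mp hUk
      linarith only [this]
    have hC1 : R.Gfr 2 * (c / Real.log 4) ≤ R.Gfr 2 * c := mul_le_mul_of_nonneg_left (div_le_self hc.le hlog) h2
    have hD1 : R.Gfr 2 * c ≤ κ₀ / 12 := by
      have hpos : 0 < 12 * (R.Gfr 2 + 1) := by positivity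
      have := (le_div_iff₀ hpos).mp hcle
      linarith only [this, hc.le]
    rw [hAdef]; linarith only [hA1, hB1, hC1, hD1, hκ₀pos]
  -- per step `k`: k3c4-p2's overlap-defect rate (constant depends on `k`, `β`, `μ` only)
  have hC : ∀ k : ℕ, ∃ C : ℝ, 0 ≤ C ∧ ∀ (L M : ℕ) [NeZero L] [NeZero M] (K K' : TrigPolyC4v),
      (∀ p : Momentum, ∀ j ≤ 2, ‖iteratedFDeriv ℝ j (frameShift K) p‖ ≤ A) →
      (∀ p : Momentum, ∀ j ≤ 2, ‖iteratedFDeriv ℝ j (frameShift K') p‖ ≤ A) →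
      klScale klE0 (k + 1) * β < π * (2 * M - 3) → 2 * |2 * π / (L : ℝ)| ≤ 1 / 10 →
      ∀ ε : ℝ, (∀ j ≤ 2, (fsub K' K).coeffNorm j ≤ ε) →
        (∀ Y' : SpaceTimeIdx L M × SectorLeg (sectorCount (k + 1)),
          imagTimeWeight β M * ∑ Y : SpaceTimeIdx L M × SectorLeg (sectorCount k),
            ‖(sectorAnalysisMatrix L M β (klAnisoFamily L M β μ K' klE0 (k + 1)) *
              sectorSubMatrix L M β (bgmFatMultiplier L M klE0 β (nambuXiCT L μ K') k) -
              sectorAnalysisMatrix L M β (klAnisoFamily L M β μ K klE0 (k + 1)) *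
              sectorSubMatrix L M β (bgmFatMultiplier L M klE0 β (nambuXiCT L μ K) k)) Y' Y‖ ≤ C * ε) ∧
        (∀ Y : SpaceTimeIdx L M × SectorLeg (sectorCount k),
          imagTimeWeight β M * ∑ Y' : SpaceTimeIdx L M × SectorLeg (sectorCount (k + 1)),
            ‖(sectorAnalysisMatrix L M β (klAnisoFamily L M β μ K' klE0 (k + 1)) *
              sectorSubMatrix L M β (bgmFatMultiplier L M klE0 β (nambuXiCT L μ K') k) -
              sectorAnalysisMatrix L M β (klAnisoFamily L M β μ K klE0 (k + 1)) *
              sectorSubMatrix L M β (bgmFatMultiplier L M klE0 β (nambuXiCT L μ K) k)) Y' Y‖ ≤ C * ε) := fun k =>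
    exists_overlapDefect_rate_of_frames B hADt he (by norm_num : (0 : ℝ) < 1 / 10) (by norm_num : (1 / 10 : ℝ) ≤ 1) hgap h3 hlo hhi hβ0 hρA
      (n₁ := k + 1) (n₂ := k) le_rfl hd₀ hd₀1 hd₀2 hd₀3
  choose Cf hCf0 hCf using hC
  -- the tower's frame comparison numerators (orders `0, 1, 2`)
  set Ac : ℕ → ℝ := fun r => ∑ m ∈ range (nScales β + 1), 4 * (2 * klFlowDeg m + 1) * (1 + 4 * klFlowDeg m) ^ r * Q.CL β m with hAc
  set Aabs : ℝ := |Ac 0| + |Ac 1| + |Ac 2| with hAabs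
  have hAabs0 : 0 ≤ Aabs := by positivity
  have hAj : ∀ j ≤ 2, |Ac j| ≤ Aabs := by
    intro j hj
    have h0 := abs_nonneg (Ac 0); have h1 := abs_nonneg (Ac 1); have h2 := abs_nonneg (Ac 2)
    interval_cases j <;> simp only [hAabs] <;> linarith
  -- the rates `δ j L = min 1 (C'_j · Aabs / L)`, `C'_0 = 0`, `C'_{k+1} = Cf k`
  set Cg : ℕ → ℝ := fun j => Nat.casesOn j 0 (fun k => Cf k) with hCg
  have hCg0 : ∀ j, 0 ≤ Cg j := fun j => by cases j with | zero => exact le_rfl | succ k => exact hCf0 k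
  have hCg_succ : ∀ k, Cg (k + 1) = Cf k := fun k => rfl
  set Csum : ℝ := ∑ j ∈ range (nScales β + 2), Cg j with hCsum
  have hCg_le : ∀ j, j ≤ nScales β + 1 → Cg j ≤ Csum := fun j hj =>
    single_le_sum (f := Cg) (fun i _ => hCg0 i) (mem_range.2 (by omega))
  refine ⟨fun j L => min 1 (Cg j * (Aabs / L)), fun j L => ⟨le_min zero_le_one (by have := hCg0 j; positivity), min_le_left _ _⟩,
    fun j => ?_, max (max Lstar (klEngL₃ β U)) (⌈Csum * Aabs⌉₊ + 1),
    fun L b => max (max (Mstar L) (Mstar (b * L))) (max (max (klEngM₃ β U L) (klEngM₃ β U (b * L))) (max (Q.M0 β L) (Q.M0 β (b * L)))),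
    fun L b M _ _ _ hL hM => ?_⟩
  · -- `δ j → 0`
    have h := (tendsto_const_div_atTop_nhds_zero_nat Aabs).const_mul (Cg j)
    rw [mul_zero] at h
    refine squeeze_zero (fun L => le_min zero_le_one (by have := hCg0 j; positivity)) (fun L => min_le_right _ _) ?_
    simpa using h
  -- one instance
  dsimp only at hL hM
  have hLs : Lstar ≤ L := by omega
  have hL3 : klEngL₃ β U ≤ L := by omega
  have hLcap : ⌈Csum * Aabs⌉₊ + 1 ≤ L := by omega
  have hMs : Mstar L ≤ M := by omega
  have hMsb : Mstar (b * L) ≤ M := by omega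
  have hM3b : klEngM₃ β U (b * L) ≤ M := by omega
  have hMQ : Q.M0 β L ≤ M := by omega
  have hMQb : Q.M0 β (b * L) ≤ M := by omega
  have hb1 : 1 ≤ b := Nat.pos_of_ne_zero fun hb => NeZero.ne (b * L) (by rw [hb, Nat.zero_mul])
  have hLbL : L ≤ b * L := Nat.le_mul_of_pos_left L hb1
  have hL3b : klEngL₃ β U ≤ b * L := hL3.trans hLbL
  have hn1 : 1 ≤ nScales β + 1 := Nat.le_add_left 1 _
  have hL0 : (0 : ℝ) < L := Nat.cast_pos.2 (Nat.pos_of_ne_zero (NeZero.ne L))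
  -- the two admissible flow frames
  have hK : FrameOK R U (nScales β) μ (klFlowFrameU L M β U μ (nScales β + 1)) :=
    frameOK_klFlowFrameU_of_histP_le hR2 hn1 le_rfl le_rfl (histP_top_of_towerP hT hLs hMs)
  have hKb : FrameOK R U (nScales β) μ (klFlowFrameU (b * L) M β U μ (nScales β + 1)) :=
    frameOK_klFlowFrameU_of_histP_le hR2 hn1 le_rfl le_rfl (histP_top_of_towerP hT (hLs.trans hLbL) hMsb)
  -- the scale thresholds on the fine lattice
  have hLβ : β ^ 2 ≤ ((b * L : ℕ) : ℝ) := sq_le_of_klEngL₃_le hL3b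
  have hMβ : β ≤ (M : ℝ) := le_of_klEngM₃_le hβmin hL3b hM3b
  -- the frame comparison: `coeffNorm j (K_L ⊖ K_{bL}) ≤ Aabs / L`
  have hcoeff : ∀ j ≤ 2, (fsub (klFlowFrameU L M β U μ (nScales β + 1)) (klFlowFrameU (b * L) M β U μ (nScales β + 1))).coeffNorm j ≤ Aabs / L := by
    intro j hj
    have h := coeffNorm_fsub_klFlowFrameU_le_of_towerV17F2 hμ hT hLs hLbL hMs hMQ hMsb hMQb (n := nScales β + 1) le_rfl j
    refine h.trans ?_
    calc (∑ m ∈ range (nScales β + 1), 4 * (2 * klFlowDeg m + 1) * (1 + 4 * klFlowDeg m) ^ j * Q.CL β m) / L = Ac j / L := by rw [hAc]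
      _ ≤ |Ac j| / L := div_le_div_of_nonneg_right (le_abs_self _) hL0.le
      _ ≤ Aabs / L := div_le_div_of_nonneg_right (hAj j hj) hL0.le
  -- the cap: `Cg j · Aabs / L ≤ 1` for `j ≤ n_β + 1`
  have hcap : ∀ j, j ≤ nScales β + 1 → Cg j * (Aabs / L) ≤ 1 := by
    intro j hj
    have h1 : Cg j * (Aabs / L) ≤ Csum * Aabs / L := by
      rw [mul_div_assoc]
      exact mul_le_mul_of_nonneg_right (hCg_le j hj) (by positivity)
    refine h1.trans ?_
    rw [div_le_one hL0]
    have h2 : Csum * Aabs ≤ (⌈Csum * Aabs⌉₊ : ℝ) := Nat.le_ceil _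
    have h3 : ((⌈Csum * Aabs⌉₊ + 1 : ℕ) : ℝ) ≤ L := by exact_mod_cast hLcap
    push_cast at h3
    linarith
  have hδeq : ∀ j, j ≤ nScales β + 1 → min 1 (Cg j * (Aabs / L)) = Cg j * (Aabs / L) := fun j hj => min_eq_right (hcap j hj)
  -- the rows / columns per step
  have hstep : ∀ k, k + 1 ≤ nScales β + 1 →
      (∀ x, ∑ y, ‖klSrcTransfer (b * L) M β μ (klFlowFrameU (b * L) M β U μ (nScales β + 1)) k x y -
          klSrcTransfer (b * L) M β μ (klFlowFrameU L M β U μ (nScales β + 1)) k x y‖ ≤ Cf k * (Aabs / L)) ∧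
      (∀ y, ∑ x, ‖klSrcTransfer (b * L) M β μ (klFlowFrameU (b * L) M β U μ (nScales β + 1)) k x y -
          klSrcTransfer (b * L) M β μ (klFlowFrameU L M β U μ (nScales β + 1)) k x y‖ ≤ Cf k * (Aabs / L)) := by
    intro k hk
    obtain ⟨hΛM, -, hzL3, -, -⟩ := regime_scale_thresholds₃ hβmin hLβ hMβ hk
    have hΛM' : klScale klE0 (k + 1) * β < π * (2 * M - 3) := lt_of_lt_of_le hΛM (by nlinarith [Real.pi_pos])
    have hzL : 2 * |2 * π / (((b * L : ℕ)) : ℝ)| ≤ 1 / 10 := by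
      have hx : 0 ≤ |2 * π / (((b * L : ℕ)) : ℝ)| := abs_nonneg _
      have h2k : (1 : ℝ) ≤ (2 : ℝ) ^ (k + 1) := one_le_pow₀ (by norm_num)
      have h1 : 2 * |2 * π / (((b * L : ℕ)) : ℝ)| ≤ 3 * |2 * π / (((b * L : ℕ)) : ℝ)| * ((2 : ℝ) ^ (k + 1) + 1 / 2) := by
        have h15 : (2 : ℝ) ≤ 3 * ((2 : ℝ) ^ (k + 1) + 1 / 2) := by linarith
        calc 2 * |2 * π / (((b * L : ℕ)) : ℝ)| ≤ 3 * ((2 : ℝ) ^ (k + 1) + 1 / 2) * |2 * π / (((b * L : ℕ)) : ℝ)| :=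
            mul_le_mul_of_nonneg_right h15 hx
          _ = _ := by ring
      exact h1.trans hzL3
    have hrate := hCf k (b * L) M (klFlowFrameU (b * L) M β U μ (nScales β + 1)) (klFlowFrameU L M β U μ (nScales β + 1))
      (hAK _ hKb) (hAK _ hK) hΛM' hzL (Aabs / L) hcoeff
    have hδ0 : 0 ≤ Cf k * (Aabs / L) := by have := hCf0 k; positivity
    refine ⟨sum_norm_klSrcTransfer_sub_row_le β μ _ _ k hδ0 (fun Y' => ?_), sum_norm_klSrcTransfer_sub_col_le β μ _ _ k hδ0 (fun Y => ?_)⟩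
    · refine le_trans (le_of_eq ?_) (hrate.1 Y')
      rw [mul_sum]
      exact sum_congr rfl fun Y _ => by rw [norm_klReanalysis_sub_apply hβ0.le, Matrix.sub_apply, Matrix.sub_apply, norm_sub_rev]
    · refine le_trans (le_of_eq ?_) (hrate.2 Y)
      rw [mul_sum]
      exact sum_congr rfl fun Y' _ => by rw [norm_klReanalysis_sub_apply hβ0.le, Matrix.sub_apply, Matrix.sub_apply, norm_sub_rev]
  refine ⟨fun j hj x => ?_, fun j hj y => ?_⟩
  · show _ ≤ min 1 (Cg j * (Aabs / L))
    rcases j with _ | k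
    · simp only [klTowerTransfer, sub_self, norm_zero, sum_const_zero]
      exact le_min zero_le_one (by have := hCg0 0; positivity)
    · rw [hδeq (k + 1) (by omega), hCg_succ]
      exact (hstep k (by omega)).1 x
  · show _ ≤ min 1 (Cg j * (Aabs / L))
    rcases j with _ | k
    · simp only [klTowerTransfer, sub_self, norm_zero, sum_const_zero]
      exact le_min zero_le_one (by have := hCg0 0; positivity)
    · rw [hδeq (k + 1) (by omega), hCg_succ]
      exact (hstep k (by omega)).2 y

end Summit.HubbardSuperconductivity.HubbardSuperconductivity.Theorems.TwoVolumeSource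

end
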